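import Summits.BirchSwinnertonDyer.Rank1Residual.X11b.Three.ClassRecordHsiehSupply
import Summits.BirchSwinnertonDyer.Rank1Residual.GaloisImage.PropagatedConditionCardEP
import HarnessLib

/-!
# Class X11b at `p = 3` (team N8/O2 = cell `b2b-bsdres`, seat x11b3-p3): the class theorem of
# record v4.3 and its reading v4.5 WITHOUT the binder `hEP` — Tate's local Euler–Poincaré
# characteristic formula being a theorem of the tree

HONEST FRAMING (verbatim, cell `b2b-bsdres`, run/shared/lean/b2b/bsd-rank1-residual/): the goal of
the cell is to DELETE the COMBINATION-SHAPED residual classes for ALL analytic-rank `≤ 1` curves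
over `ℚ` — "full BSD formula for every rank `≤ 1` curve in class `C`" assembled STRICTLY from
published theorems — so that the rank-`≤ 1` remainder becomes exactly the CONSTRUCTION-SHAPED
classes, which are TYPED (missing-input Props), NOT attempted; this is not "finishing BSD".
Team N8/O2 (X11b at `3`; RESIDUAL-MAP §I O2 OPEN). Research route; nothing booked; NO label
changes. THEOREMS ONLY (no definition, no named fact, no `sorry`). The class theorem OF RECORD is
v4.3 (`Three/ClassRecordHalves.lean`, p261173) and its READING is v4.5
(`Three/ClassRecordHsiehSupply.lean`, p266187); both files are byte-untouched by this one, and the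
record-pointer is the team lead's call — this file does not claim to move it.

## What this file does

Both records carry, among their published binders, the cited input

  `hEP : ∀ (K : Type) [Field K] [NumberField K] (v : HeightOneSpectrum (𝓞 K)),
    localEulerPoincareCharacteristic (v.adicCompletion K)`

— Tate's local Euler–Poincaré characteristic formula `#H⁰ · #H² = #H¹ · ‖#M‖_v` for a finite
Galois module over a non-archimedean local field of characteristic `0` (Milne, *ADT*, I Thm. 2.8;
Tate 1963). That named fact is now a THEOREM of the tree: `EPCTate.localEulerPoincareCharacteristic`
(team n1011, `GaloisImage/EPCTateFormula.lean`, p300886) and, in exactly the binder's family shape,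
`GaloisImage.EP.localEulerPoincareCharacteristic_adicCompletion`
(`GaloisImage/PropagatedConditionCardEP.lean`). The team referee's hypothesis police H104 (cells
REFEREE §29, ROUND 26): "the binder may be DROPPED from every consumer; a consumer still carrying
`hEP` is not wrong, merely unreduced".

This file re-issues the four record theorems as PRIMED TWINS with `hEP` SUPPLIED by that theorem,
every other binder VERBATIM and in the record's order, conclusions VERBATIM:

* §1 `forall_bsdp_of_classRecord_v43'` / `forall_missingInputAt_of_classRecord_v43'` — CLASS RECORD
  v4.3 (§1 / §2 of `Three/ClassRecordHalves.lean`): PUBLISHED binders 20 → 19;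
* §2 `forall_bsdp_of_classRecord_v45'` / `forall_missingInputAt_of_classRecord_v45'` — READING v4.5
  (§3 / §4 of `Three/ClassRecordHsiehSupply.lean`): PUBLISHED binders 21 → 20.

Each proof is the unprimed record theorem applied to its own binders with
`GaloisImage.EP.localEulerPoincareCharacteristic_adicCompletion` in the `hEP` slot. One cited input
fewer; NOTHING is discharged on the residual map: `hPT` (Poitou–Tate) and the other published
binders stay cited; road (a)'s per-pair `RegulatorNonvanishingAt W 3`, road (b)'s / road (d)'s three
HALVES (v4.3) resp. the named descent residual `Three.HsiehDescentAt₃ W` + H2 ∧ H3 (v4.5), the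
(T2′)₃ binders and the corner's three typed inputs are UNCHANGED; the conjecture node
`Three.HsiehDescentAt₃` with its four antecedents, the TRUE-OPEN count 1 684 = 722 + 961 + 1 and the
corner 296 (EVIDENCE) are UNCHANGED; CONDITIONAL on every listed binder; nothing booked; O2 OPEN;
X11 ∧ `r = 1` ∧ `p = 3` stays CONSTRUCTION-SHAPED (R6.2); no label / count / mark / tier moves.

References: [MilneADT2006] I §2 Thm. 2.8 (p. 31), I Thm. 4.10(b); [Castella2018] Thm. 2.3 (p. 5),
Thm. 3.2 (p. 9), §5 (p. 12) (arXiv:1704.06608); [Hsieh2014] Thm. 1 (arXiv:1112.1580 pp. 3–4);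
[GreenbergLNM1716] §3 Lemma 3.3; [Kolyvagin1990] Thm. A; [Skinner2016PacificMC] Thm. A, Thm. C;
[SteinWuthrich2013] Thm. 6.1, §4.2; [Disegni2020] Thm. 1; [MatarNekovar2019] Thm. 0.3;
[BarriosEtAl2025] Thm. 5.1; [Wuthrich2014] Prop. 21; [Miller2011LMS] Def. 1.1.
-/

noncomputable section

open scoped Classical

open WeierstrassCurve NumberField IsDedekindDomain Field Literature.NumberTheory.EllipticCurves
  Rat.HeightOneSpectrum
  Literature.NumberTheory.DiophantineGeometry
  Literature.NumberTheory.EllipticCurves.GreenbergSelmer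
  Literature.NumberTheory.EllipticCurves.ModularForms
  Literature.NumberTheory.EllipticCurves.Rank1Residual
  Literature.NumberTheory.EllipticCurves.Rank1Residual.Typed
  Literature.NumberTheory.EllipticCurves.Wuthrich2014
  Literature.NumberTheory.EllipticCurves.BalakrishnanEtAl2019
  Literature.NumberTheory.EllipticCurves.Skinner2016
  Literature.NumberTheory.EllipticCurves.SteinWuthrich2013
  Literature.NumberTheory.EllipticCurves.Disegni2020
  Literature.NumberTheory.EllipticCurves.BarriosEtAl2025
  Literature.NumberTheory.QuadraticFields.Quadratic
  Literature.NumberTheory.Automorphic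
  Literature.NumberTheory.GaloisRepresentations Literature.NumberTheory.GaloisCohomology
  Summit.BirchSwinnertonDyer.Rank1Residual.X11b.AcSelmer
  Summit.BirchSwinnertonDyer.Rank1Residual.X11b.LocBridge

namespace Summit.BirchSwinnertonDyer.Rank1Residual.X11b.Three

/-! ### §1. CLASS RECORD v4.3 without `hEP` -/

/-- **X11b at `p = 3`, WHOLE CLASS — CLASS RECORD v4.3 IN KERNEL FORM, `hEP` SUPPLIED.**
`Three.forall_bsdp_of_classRecord_v43` (p261173) with its cited binder `hEP` (Tate's local
Euler–Poincaré characteristic formula at every `K_v`) `:=` the tree theorem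
`GaloisImage.EP.localEulerPoincareCharacteristic_adicCompletion` (n1011, from
`EPCTate.localEulerPoincareCharacteristic`, p300886) — i.e. v4.3's statement with `hEP` REMOVED and
nothing else changed. Binder list: PUBLISHED (19) = v4.3's twenty minus `hEP`; road (a) NONSPLIT(3)
∧ (ram): `hReg`; road (b) SPLIT(3) ∧ (ram): `hHb` (the three HALVES H1 = BDP-EXISTS@3, H2 =
BDP-VALUE@3, H3 = MI-W3; TYPED, construction-shaped, no source at `3`), `hSh`, `hUα`, `hUγ`; road (d)
`¬Ram ∧ Surj`: `hHd`, `hU₀`; the (T4″)₃ corner: `hCL`, `hCT`, `hCU`. CONDITIONAL on every listed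
binder; nothing booked; one cited input fewer, nothing discharged on the residual map; the
record-pointer (v4.3) is not moved by this twin; labels UNCHANGED (X11 ∧ `r = 1` ∧ `p = 3`
CONSTRUCTION-SHAPED, R6.2; O2 OPEN). [cite: MilneADT2006, I §2 Thm. 2.8 (p. 31) and I Thm. 4.10(b)]
[cite: Castella2018, Thm. 2.3 (p. 5), Thm. 3.2 (p. 9), §5 (p. 12) (arXiv:1704.06608; assembly shape, inputs typed)]
[cite: GreenbergLNM1716, §3 Lemma 3.3 (p. 87)] [cite: Skinner2016PacificMC, Thm. A and Thm. C (§1)]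
[cite: SteinWuthrich2013, Thm. 6.1, §4.2] [cite: Disegni2020, Thm. 1 (§1.2)]
[cite: MatarNekovar2019, Thm. 0.3 (p. 456)] [cite: BarriosEtAl2025, Thm. 5.1 (rows R = I₀)]
[cite: Wuthrich2014, Prop. 21 (p. 400)] [cite: Miller2011LMS, Def. 1.1] -/
theorem forall_bsdp_of_classRecord_v43' [Fact (Nat.Prime 3)]
    -- PUBLISHED: the named facts of route p2, WITHOUT `hEP`
    (hGZ : ∀ (N : ℕ) [NeZero N] (W : WeierstrassCurve ℚ) (K : Type) [Field K] [NumberField K],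
      gross_zagier N W K)
    (hKo : ∀ (N : ℕ) [NeZero N] (W : WeierstrassCurve ℚ) (K : Type) [Field K] [NumberField K],
      kolyvagin N W K)
    (hB : ∀ (N : ℕ) [NeZero N] (W : WeierstrassCurve ℚ) (K : Type) [Field K] [NumberField K],
      Kolyvagin1990_padicValNat_card_sha_le N W K)
    (hSk : Skinner2016.thmC_padicValRat_bsd_rank_zero) (hWu : sha_dvd_analyticSha)
    (hGZK : rank_eq_analyticRank_of_analyticRank_le_one) (hmod : hasEntireLFunction_rat)
    (hnf : exists_isNewformOf) (hHL : HoffsteinLuo1997_exists_twist_L_one_ne_zero)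
    (hMaz : mazur_not_dvd_maninConstant_of_odd)
    (hPT : ∀ (K : Type) [Field K] [NumberField K], poitouTate_sum_localTatePairing_eq_zero K)
    -- PUBLISHED: Friedberg–Hoffstein, Barrios et al. 2025 (binder at `2`), road (a)'s five,
    -- Matar–Nekovář 2019 Thm. 0.3 (the corner's `K`-bound)
    (hFH : friedbergHoffstein_exists_twist_ne_zero_inertAt)
    (hBR : localTamagawaNumber_quadraticTwist_two_mem_of_goodReduction)
    (hSkA : thmA_charIdeal_multiplicative) (hJn : thm61_nonsplitMultiplicative)
    (hHn : exists_isMultCanonical) (hD : thm1_padicBSD_rankOne_multiplicative)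
    (hpar : nonempty_modularParametrizationData)
    (hMN : ∀ (N : ℕ) [NeZero N] (W : WeierstrassCurve ℚ) (K : Type) [Field K] [NumberField K],
      MatarNekovar2019.thm03_padicValNat_card_sha_le_of_irreducible N W K)
    -- ROAD (a) NONSPLIT(3) ∧ (ram): ONE per-pair input
    (hReg : ∀ (W : WeierstrassCurve ℚ) [W.IsElliptic] [W.IsGloballyMinimal],
      ClassX11b W 3 → Ram W 3 → ¬ W.HasSplitMultiplicativeReductionAtPrime 3 →
        ClassClosure.RegulatorNonvanishingAt W 3)
    -- ROAD (b) SPLIT(3) ∧ (ram): the three HALVES (no control binder), displays on pure-β, α / γ∖α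
    (hHb : ∀ (W : WeierstrassCurve ℚ) [W.IsElliptic] [W.IsGloballyMinimal],
      ClassX11b W 3 → Ram W 3 → W.HasSplitMultiplicativeReductionAtPrime 3 →
        BDPExistsAt₃ W ∧ BDPValueAt₃ W ∧ IMCDivAt₃ W)
    (hSh : ∀ (W : WeierstrassCurve ℚ) [W.IsElliptic] [W.IsGloballyMinimal],
      ClassX11b W 3 → Ram W 3 → W.HasSplitMultiplicativeReductionAtPrime 3 → ¬ ShapeAlpha W →
        ¬ ShapeGamma W → 3 ∣ W.tamagawaProduct → P2ShimuraDisplaysAt W 3)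
    (hUα : ∀ (W : WeierstrassCurve ℚ) [W.IsElliptic] [W.IsGloballyMinimal],
      ClassX11b W 3 → Ram W 3 → ShapeAlpha W → Typed.MissingUpperBoundAt W 3)
    (hUγ : ∀ (W : WeierstrassCurve ℚ) [W.IsElliptic] [W.IsGloballyMinimal],
      ClassX11b W 3 → Ram W 3 → W.HasSplitMultiplicativeReductionAtPrime 3 → ¬ ShapeAlpha W →
        ShapeGamma W → Typed.MissingUpperBoundAt W 3)
    -- ROAD (d) `¬Ram ∧ Surj`: the three HALVES (no control binder) + the upper half
    (hHd : ∀ (W : WeierstrassCurve ℚ) [W.IsElliptic] [W.IsGloballyMinimal],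
      ClassX11b W 3 → ¬ Ram W 3 → Surj W 3 → BDPExistsAt₃ W ∧ BDPValueAt₃ W ∧ IMCDivAt₃ W)
    (hU₀ : ∀ (W : WeierstrassCurve ℚ) [W.IsElliptic] [W.IsGloballyMinimal],
      ClassX11b W 3 → Surj W 3 → ¬ Ram W 3 → Typed.MissingUpperBoundAt W 3)
    -- THE (T4″)@3 CORNER `¬Surj` (x11b3-p8's typed inputs, `CornerResidual.lean`, p253638)
    (hCL : ∀ (W : WeierstrassCurve ℚ) [W.IsElliptic] [W.IsGloballyMinimal], CornerStepLAt W)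
    (hCT : ∀ (W : WeierstrassCurve ℚ) [W.IsElliptic] [W.IsGloballyMinimal], CornerTwistAt W)
    (hCU : ∀ (W : WeierstrassCurve ℚ) [W.IsElliptic] [W.IsGloballyMinimal], CornerUpperAt W)
    (W : WeierstrassCurve ℚ) [W.IsElliptic] [W.IsGloballyMinimal] (hX : ClassX11b W 3) :
    BSDp W 3 :=
  forall_bsdp_of_classRecord_v43 hGZ hKo hB hSk hWu hGZK hmod hnf hHL hMaz hPT
    GaloisImage.EP.localEulerPoincareCharacteristic_adicCompletion hFH hBR hSkA hJn hHn hD hpar hMN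
    hReg hHb hSh hUα hUγ hHd hU₀ hCL hCT hCU W hX

/-- **CLASS RECORD v4.3 ⟹ the CLASS's typed missing input at every X11b@3 pair, `hEP` SUPPLIED.**
`Three.forall_missingInputAt_of_classRecord_v43` (p261173 §2) with its cited binder `hEP` `:=`
`GaloisImage.EP.localEulerPoincareCharacteristic_adicCompletion`: under exactly the binders of
`forall_bsdp_of_classRecord_v43'` (19 published facts; road (a)'s per-pair
`RegulatorNonvanishingAt W 3`; road (b)'s / road (d)'s three HALVES + (T2′)₃ binders; the corner's
three typed inputs), the typed residual of RESIDUAL-MAP §I O2 / REFEREE R6.2,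
`X11Three.MissingInputAt W`, holds at every pair of the class. CONDITIONAL; nothing booked; one cited
input fewer, nothing discharged on the residual map; O2 OPEN; no label change.
[cite: MilneADT2006, I §2 Thm. 2.8 (p. 31)] [cite: Miller2011LMS, §1 and Def. 1.1]
[cite: Castella2018, Thm. 2.3 (p. 5), Thm. 3.2 (p. 9), §5 (p. 12)]
[cite: Skinner2016PacificMC, Thm. A and Thm. C (§1)] [cite: Disegni2020, Thm. 1 (§1.2)]
[cite: MatarNekovar2019, Thm. 0.3 (p. 456)] [cite: BarriosEtAl2025, Thm. 5.1 (rows R = I₀)] -/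
theorem forall_missingInputAt_of_classRecord_v43' [Fact (Nat.Prime 3)]
    (hGZ : ∀ (N : ℕ) [NeZero N] (W : WeierstrassCurve ℚ) (K : Type) [Field K] [NumberField K],
      gross_zagier N W K)
    (hKo : ∀ (N : ℕ) [NeZero N] (W : WeierstrassCurve ℚ) (K : Type) [Field K] [NumberField K],
      kolyvagin N W K)
    (hB : ∀ (N : ℕ) [NeZero N] (W : WeierstrassCurve ℚ) (K : Type) [Field K] [NumberField K],
      Kolyvagin1990_padicValNat_card_sha_le N W K)
    (hSk : Skinner2016.thmC_padicValRat_bsd_rank_zero) (hWu : sha_dvd_analyticSha)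
    (hGZK : rank_eq_analyticRank_of_analyticRank_le_one) (hmod : hasEntireLFunction_rat)
    (hnf : exists_isNewformOf) (hHL : HoffsteinLuo1997_exists_twist_L_one_ne_zero)
    (hMaz : mazur_not_dvd_maninConstant_of_odd)
    (hPT : ∀ (K : Type) [Field K] [NumberField K], poitouTate_sum_localTatePairing_eq_zero K)
    (hFH : friedbergHoffstein_exists_twist_ne_zero_inertAt)
    (hBR : localTamagawaNumber_quadraticTwist_two_mem_of_goodReduction)
    (hSkA : thmA_charIdeal_multiplicative) (hJn : thm61_nonsplitMultiplicative)
    (hHn : exists_isMultCanonical) (hD : thm1_padicBSD_rankOne_multiplicative)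
    (hpar : nonempty_modularParametrizationData)
    (hMN : ∀ (N : ℕ) [NeZero N] (W : WeierstrassCurve ℚ) (K : Type) [Field K] [NumberField K],
      MatarNekovar2019.thm03_padicValNat_card_sha_le_of_irreducible N W K)
    (hReg : ∀ (W : WeierstrassCurve ℚ) [W.IsElliptic] [W.IsGloballyMinimal],
      ClassX11b W 3 → Ram W 3 → ¬ W.HasSplitMultiplicativeReductionAtPrime 3 →
        ClassClosure.RegulatorNonvanishingAt W 3)
    (hHb : ∀ (W : WeierstrassCurve ℚ) [W.IsElliptic] [W.IsGloballyMinimal],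
      ClassX11b W 3 → Ram W 3 → W.HasSplitMultiplicativeReductionAtPrime 3 →
        BDPExistsAt₃ W ∧ BDPValueAt₃ W ∧ IMCDivAt₃ W)
    (hSh : ∀ (W : WeierstrassCurve ℚ) [W.IsElliptic] [W.IsGloballyMinimal],
      ClassX11b W 3 → Ram W 3 → W.HasSplitMultiplicativeReductionAtPrime 3 → ¬ ShapeAlpha W →
        ¬ ShapeGamma W → 3 ∣ W.tamagawaProduct → P2ShimuraDisplaysAt W 3)
    (hUα : ∀ (W : WeierstrassCurve ℚ) [W.IsElliptic] [W.IsGloballyMinimal],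
      ClassX11b W 3 → Ram W 3 → ShapeAlpha W → Typed.MissingUpperBoundAt W 3)
    (hUγ : ∀ (W : WeierstrassCurve ℚ) [W.IsElliptic] [W.IsGloballyMinimal],
      ClassX11b W 3 → Ram W 3 → W.HasSplitMultiplicativeReductionAtPrime 3 → ¬ ShapeAlpha W →
        ShapeGamma W → Typed.MissingUpperBoundAt W 3)
    (hHd : ∀ (W : WeierstrassCurve ℚ) [W.IsElliptic] [W.IsGloballyMinimal],
      ClassX11b W 3 → ¬ Ram W 3 → Surj W 3 → BDPExistsAt₃ W ∧ BDPValueAt₃ W ∧ IMCDivAt₃ W)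
    (hU₀ : ∀ (W : WeierstrassCurve ℚ) [W.IsElliptic] [W.IsGloballyMinimal],
      ClassX11b W 3 → Surj W 3 → ¬ Ram W 3 → Typed.MissingUpperBoundAt W 3)
    (hCL : ∀ (W : WeierstrassCurve ℚ) [W.IsElliptic] [W.IsGloballyMinimal], CornerStepLAt W)
    (hCT : ∀ (W : WeierstrassCurve ℚ) [W.IsElliptic] [W.IsGloballyMinimal], CornerTwistAt W)
    (hCU : ∀ (W : WeierstrassCurve ℚ) [W.IsElliptic] [W.IsGloballyMinimal], CornerUpperAt W)
    (W : WeierstrassCurve ℚ) [W.IsElliptic] [W.IsGloballyMinimal] (hX : ClassX11b W 3) :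
    X11Three.MissingInputAt W :=
  forall_missingInputAt_of_classRecord_v43 hGZ hKo hB hSk hWu hGZK hmod hnf hHL hMaz hPT
    GaloisImage.EP.localEulerPoincareCharacteristic_adicCompletion hFH hBR hSkA hJn hHn hD hpar hMN
    hReg hHb hSh hUα hUγ hHd hU₀ hCL hCT hCU W hX

/-! ### §2. READING v4.5 without `hEP` -/

/-- **X11b at `p = 3`, WHOLE CLASS — CLASS RECORD v4.5 (a READING of v4.3), `hEP` SUPPLIED.**
`Three.forall_bsdp_of_classRecord_v45` (p266187 §3) with its cited binder `hEP` `:=`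
`GaloisImage.EP.localEulerPoincareCharacteristic_adicCompletion` — v4.5's statement with `hEP`
REMOVED and nothing else changed. Binder list: PUBLISHED (20) = v4.5's twenty-one minus `hEP`
(includes Hsieh 2014 Thm. 1, `hH`); road (a): `hReg`; road (b): the named descent residual `hDb : … →
HsiehDescentAt₃ W` (S24-b, NOT in print at `3 ∣ N`), `hHb` (H2 ∧ H3), `hSh`, `hUα`, `hUγ`; road (d):
`hDd`, `hHd`, `hU₀`; corner: `hCL`, `hCT`, `hCU`. The class theorem OF RECORD is v4.3 and v4.5 is its
reading ((t) read, (λ) supplied); neither pointer is moved by this twin. CONDITIONAL on every listed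
binder; nothing booked; one cited input fewer, nothing discharged on the residual map; labels
UNCHANGED (X11 ∧ `r = 1` ∧ `p = 3` CONSTRUCTION-SHAPED, R6.2; O2 OPEN).
[cite: MilneADT2006, I §2 Thm. 2.8 (p. 31) and I Thm. 4.10(b)] [cite: Hsieh2014, Thm. 1 (arXiv:1112.1580 pp. 3–4)]
[cite: Castella2018, Thm. 2.3 (p. 5), Thm. 3.2 (p. 9), §5 (p. 12)] [cite: GreenbergLNM1716, §3 Lemma 3.3 (p. 87)]
[cite: Skinner2016PacificMC, Thm. A and Thm. C (§1)] [cite: SteinWuthrich2013, Thm. 6.1, §4.2]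
[cite: Disegni2020, Thm. 1 (§1.2)] [cite: MatarNekovar2019, Thm. 0.3 (p. 456)]
[cite: BarriosEtAl2025, Thm. 5.1 (rows R = I₀)] [cite: Wuthrich2014, Prop. 21 (p. 400)] [cite: Miller2011LMS, Def. 1.1] -/
theorem forall_bsdp_of_classRecord_v45' [Fact (Nat.Prime 3)]
    -- PUBLISHED: the named facts of route p2, WITHOUT `hEP`
    (hGZ : ∀ (N : ℕ) [NeZero N] (W : WeierstrassCurve ℚ) (K : Type) [Field K] [NumberField K],
      gross_zagier N W K)
    (hKo : ∀ (N : ℕ) [NeZero N] (W : WeierstrassCurve ℚ) (K : Type) [Field K] [NumberField K],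
      kolyvagin N W K)
    (hB : ∀ (N : ℕ) [NeZero N] (W : WeierstrassCurve ℚ) (K : Type) [Field K] [NumberField K],
      Kolyvagin1990_padicValNat_card_sha_le N W K)
    (hSk : Skinner2016.thmC_padicValRat_bsd_rank_zero) (hWu : sha_dvd_analyticSha)
    (hGZK : rank_eq_analyticRank_of_analyticRank_le_one) (hmod : hasEntireLFunction_rat)
    (hnf : exists_isNewformOf) (hHL : HoffsteinLuo1997_exists_twist_L_one_ne_zero)
    (hMaz : mazur_not_dvd_maninConstant_of_odd)
    (hPT : ∀ (K : Type) [Field K] [NumberField K], poitouTate_sum_localTatePairing_eq_zero K)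
    -- PUBLISHED: Friedberg–Hoffstein, Barrios et al. 2025 (binder at `2`), road (a)'s five,
    -- Matar–Nekovář 2019 Thm. 0.3 (the corner's `K`-bound), Hsieh 2014 Thm. 1 (S18 (a))
    (hFH : friedbergHoffstein_exists_twist_ne_zero_inertAt)
    (hBR : localTamagawaNumber_quadraticTwist_two_mem_of_goodReduction)
    (hSkA : thmA_charIdeal_multiplicative) (hJn : thm61_nonsplitMultiplicative)
    (hHn : exists_isMultCanonical) (hD : thm1_padicBSD_rankOne_multiplicative)
    (hpar : nonempty_modularParametrizationData)
    (hMN : ∀ (N : ℕ) [NeZero N] (W : WeierstrassCurve ℚ) (K : Type) [Field K] [NumberField K],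
      MatarNekovar2019.thm03_padicValNat_card_sha_le_of_irreducible N W K)
    (hH : hsieh2014_exists_anticyclotomicPAdicLFunction)
    -- ROAD (a) NONSPLIT(3) ∧ (ram): ONE per-pair input
    (hReg : ∀ (W : WeierstrassCurve ℚ) [W.IsElliptic] [W.IsGloballyMinimal],
      ClassX11b W 3 → Ram W 3 → ¬ W.HasSplitMultiplicativeReductionAtPrime 3 →
        ClassClosure.RegulatorNonvanishingAt W 3)
    -- ROAD (b) SPLIT(3) ∧ (ram): the ONE named descent residual (S24-b), H2 ∧ H3, displays on pure-β,
    -- α / γ∖α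
    (hDb : ∀ (W : WeierstrassCurve ℚ) [W.IsElliptic] [W.IsGloballyMinimal],
      ClassX11b W 3 → Ram W 3 → W.HasSplitMultiplicativeReductionAtPrime 3 → HsiehDescentAt₃ W)
    (hHb : ∀ (W : WeierstrassCurve ℚ) [W.IsElliptic] [W.IsGloballyMinimal],
      ClassX11b W 3 → Ram W 3 → W.HasSplitMultiplicativeReductionAtPrime 3 →
        BDPValueAt₃ W ∧ IMCDivAt₃ W)
    (hSh : ∀ (W : WeierstrassCurve ℚ) [W.IsElliptic] [W.IsGloballyMinimal],
      ClassX11b W 3 → Ram W 3 → W.HasSplitMultiplicativeReductionAtPrime 3 → ¬ ShapeAlpha W →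
        ¬ ShapeGamma W → 3 ∣ W.tamagawaProduct → P2ShimuraDisplaysAt W 3)
    (hUα : ∀ (W : WeierstrassCurve ℚ) [W.IsElliptic] [W.IsGloballyMinimal],
      ClassX11b W 3 → Ram W 3 → ShapeAlpha W → Typed.MissingUpperBoundAt W 3)
    (hUγ : ∀ (W : WeierstrassCurve ℚ) [W.IsElliptic] [W.IsGloballyMinimal],
      ClassX11b W 3 → Ram W 3 → W.HasSplitMultiplicativeReductionAtPrime 3 → ¬ ShapeAlpha W →
        ShapeGamma W → Typed.MissingUpperBoundAt W 3)
    -- ROAD (d) `¬Ram ∧ Surj`: the descent residual, H2 ∧ H3, the upper half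
    (hDd : ∀ (W : WeierstrassCurve ℚ) [W.IsElliptic] [W.IsGloballyMinimal],
      ClassX11b W 3 → ¬ Ram W 3 → Surj W 3 → HsiehDescentAt₃ W)
    (hHd : ∀ (W : WeierstrassCurve ℚ) [W.IsElliptic] [W.IsGloballyMinimal],
      ClassX11b W 3 → ¬ Ram W 3 → Surj W 3 → BDPValueAt₃ W ∧ IMCDivAt₃ W)
    (hU₀ : ∀ (W : WeierstrassCurve ℚ) [W.IsElliptic] [W.IsGloballyMinimal],
      ClassX11b W 3 → Surj W 3 → ¬ Ram W 3 → Typed.MissingUpperBoundAt W 3)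
    -- THE (T4″)@3 CORNER `¬Surj` (x11b3-p8's typed inputs, `CornerResidual.lean`, p253638)
    (hCL : ∀ (W : WeierstrassCurve ℚ) [W.IsElliptic] [W.IsGloballyMinimal], CornerStepLAt W)
    (hCT : ∀ (W : WeierstrassCurve ℚ) [W.IsElliptic] [W.IsGloballyMinimal], CornerTwistAt W)
    (hCU : ∀ (W : WeierstrassCurve ℚ) [W.IsElliptic] [W.IsGloballyMinimal], CornerUpperAt W)
    (W : WeierstrassCurve ℚ) [W.IsElliptic] [W.IsGloballyMinimal] (hX : ClassX11b W 3) :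
    BSDp W 3 :=
  forall_bsdp_of_classRecord_v45 hGZ hKo hB hSk hWu hGZK hmod hnf hHL hMaz hPT
    GaloisImage.EP.localEulerPoincareCharacteristic_adicCompletion hFH hBR hSkA hJn hHn hD hpar hMN
    hH hReg hDb hHb hSh hUα hUγ hDd hHd hU₀ hCL hCT hCU W hX

/-- **CLASS RECORD v4.5 ⟹ the CLASS's typed missing input at every X11b@3 pair, `hEP` SUPPLIED.**
`Three.forall_missingInputAt_of_classRecord_v45` (p266187 §4) with its cited binder `hEP` `:=`
`GaloisImage.EP.localEulerPoincareCharacteristic_adicCompletion`: under exactly the binders of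
`forall_bsdp_of_classRecord_v45'` (20 published facts; road (a)'s per-pair
`RegulatorNonvanishingAt W 3`; road (b)'s / road (d)'s descent residual `HsiehDescentAt₃ W`, H2 ∧ H3
and (T2′)₃ binders; the corner's three typed inputs — NO λ-supply binder, NO `hEP`), the typed
residual of RESIDUAL-MAP §I O2 / REFEREE R6.2, `X11Three.MissingInputAt W`, holds at every pair of
the class. CONDITIONAL; nothing booked; one cited input fewer, nothing discharged on the residual
map; O2 OPEN; no label change.
[cite: MilneADT2006, I §2 Thm. 2.8 (p. 31)] [cite: Miller2011LMS, §1 and Def. 1.1]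
[cite: Hsieh2014, Thm. 1 (arXiv:1112.1580 pp. 3–4)]
[cite: Castella2018, Thm. 2.3 (p. 5), Thm. 3.2 (p. 9), §5 (p. 12)] [cite: Skinner2016PacificMC, Thm. A and Thm. C (§1)]
[cite: Disegni2020, Thm. 1 (§1.2)] [cite: MatarNekovar2019, Thm. 0.3 (p. 456)] [cite: BarriosEtAl2025, Thm. 5.1 (rows R = I₀)] -/
theorem forall_missingInputAt_of_classRecord_v45' [Fact (Nat.Prime 3)]
    (hGZ : ∀ (N : ℕ) [NeZero N] (W : WeierstrassCurve ℚ) (K : Type) [Field K] [NumberField K],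
      gross_zagier N W K)
    (hKo : ∀ (N : ℕ) [NeZero N] (W : WeierstrassCurve ℚ) (K : Type) [Field K] [NumberField K],
      kolyvagin N W K)
    (hB : ∀ (N : ℕ) [NeZero N] (W : WeierstrassCurve ℚ) (K : Type) [Field K] [NumberField K],
      Kolyvagin1990_padicValNat_card_sha_le N W K)
    (hSk : Skinner2016.thmC_padicValRat_bsd_rank_zero) (hWu : sha_dvd_analyticSha)
    (hGZK : rank_eq_analyticRank_of_analyticRank_le_one) (hmod : hasEntireLFunction_rat)
    (hnf : exists_isNewformOf) (hHL : HoffsteinLuo1997_exists_twist_L_one_ne_zero)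
    (hMaz : mazur_not_dvd_maninConstant_of_odd)
    (hPT : ∀ (K : Type) [Field K] [NumberField K], poitouTate_sum_localTatePairing_eq_zero K)
    (hFH : friedbergHoffstein_exists_twist_ne_zero_inertAt)
    (hBR : localTamagawaNumber_quadraticTwist_two_mem_of_goodReduction)
    (hSkA : thmA_charIdeal_multiplicative) (hJn : thm61_nonsplitMultiplicative)
    (hHn : exists_isMultCanonical) (hD : thm1_padicBSD_rankOne_multiplicative)
    (hpar : nonempty_modularParametrizationData)
    (hMN : ∀ (N : ℕ) [NeZero N] (W : WeierstrassCurve ℚ) (K : Type) [Field K] [NumberField K],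
      MatarNekovar2019.thm03_padicValNat_card_sha_le_of_irreducible N W K)
    (hH : hsieh2014_exists_anticyclotomicPAdicLFunction)
    (hReg : ∀ (W : WeierstrassCurve ℚ) [W.IsElliptic] [W.IsGloballyMinimal],
      ClassX11b W 3 → Ram W 3 → ¬ W.HasSplitMultiplicativeReductionAtPrime 3 →
        ClassClosure.RegulatorNonvanishingAt W 3)
    (hDb : ∀ (W : WeierstrassCurve ℚ) [W.IsElliptic] [W.IsGloballyMinimal],
      ClassX11b W 3 → Ram W 3 → W.HasSplitMultiplicativeReductionAtPrime 3 → HsiehDescentAt₃ W)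
    (hHb : ∀ (W : WeierstrassCurve ℚ) [W.IsElliptic] [W.IsGloballyMinimal],
      ClassX11b W 3 → Ram W 3 → W.HasSplitMultiplicativeReductionAtPrime 3 →
        BDPValueAt₃ W ∧ IMCDivAt₃ W)
    (hSh : ∀ (W : WeierstrassCurve ℚ) [W.IsElliptic] [W.IsGloballyMinimal],
      ClassX11b W 3 → Ram W 3 → W.HasSplitMultiplicativeReductionAtPrime 3 → ¬ ShapeAlpha W →
        ¬ ShapeGamma W → 3 ∣ W.tamagawaProduct → P2ShimuraDisplaysAt W 3)
    (hUα : ∀ (W : WeierstrassCurve ℚ) [W.IsElliptic] [W.IsGloballyMinimal],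
      ClassX11b W 3 → Ram W 3 → ShapeAlpha W → Typed.MissingUpperBoundAt W 3)
    (hUγ : ∀ (W : WeierstrassCurve ℚ) [W.IsElliptic] [W.IsGloballyMinimal],
      ClassX11b W 3 → Ram W 3 → W.HasSplitMultiplicativeReductionAtPrime 3 → ¬ ShapeAlpha W →
        ShapeGamma W → Typed.MissingUpperBoundAt W 3)
    (hDd : ∀ (W : WeierstrassCurve ℚ) [W.IsElliptic] [W.IsGloballyMinimal],
      ClassX11b W 3 → ¬ Ram W 3 → Surj W 3 → HsiehDescentAt₃ W)
    (hHd : ∀ (W : WeierstrassCurve ℚ) [W.IsElliptic] [W.IsGloballyMinimal],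
      ClassX11b W 3 → ¬ Ram W 3 → Surj W 3 → BDPValueAt₃ W ∧ IMCDivAt₃ W)
    (hU₀ : ∀ (W : WeierstrassCurve ℚ) [W.IsElliptic] [W.IsGloballyMinimal],
      ClassX11b W 3 → Surj W 3 → ¬ Ram W 3 → Typed.MissingUpperBoundAt W 3)
    (hCL : ∀ (W : WeierstrassCurve ℚ) [W.IsElliptic] [W.IsGloballyMinimal], CornerStepLAt W)
    (hCT : ∀ (W : WeierstrassCurve ℚ) [W.IsElliptic] [W.IsGloballyMinimal], CornerTwistAt W)
    (hCU : ∀ (W : WeierstrassCurve ℚ) [W.IsElliptic] [W.IsGloballyMinimal], CornerUpperAt W)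
    (W : WeierstrassCurve ℚ) [W.IsElliptic] [W.IsGloballyMinimal] (hX : ClassX11b W 3) :
    X11Three.MissingInputAt W :=
  forall_missingInputAt_of_classRecord_v45 hGZ hKo hB hSk hWu hGZK hmod hnf hHL hMaz hPT
    GaloisImage.EP.localEulerPoincareCharacteristic_adicCompletion hFH hBR hSkA hJn hHn hD hpar hMN
    hH hReg hDb hHb hSh hUα hUγ hDd hHd hU₀ hCL hCT hCU W hX

end Summit.BirchSwinnertonDyer.Rank1Residual.X11b.Three

end
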